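import Summits.AtomisticToContinuum.Crystallization.Theorems.FrustratedLawDichotomySingleGrainTubeA

/-!
# FrustratedLawDichotomy · crux AperiodicFrustratedLawGap (27623) — SINGLE-GRAIN TUBE, law level (§4 configurations / mean-host glue / tube targets, §5 LawLedger socket) — part B (sequel of `…FrustratedLawDichotomySingleGrainTubeA`)

Split for the 400-line cap by the landing lane (hand-2 g45); the module docstring of part A describes the whole node.  Same namespace; all FQNs unchanged.
0 sorry; standard axioms.
-/

noncomputable section

namespace Summit.AtomisticToContinuum.Crystallization.Theorems.FrustratedLawDichotomySingleGrainTube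
open MeasureTheory Metric Set Filter
open scoped ENNReal Topology BigOperators
open Literature.MathematicalPhysics.StatisticalMechanics Literature.Probability.Process
open Summit.AtomisticToContinuum.Crystallization.Theorems.ChargedEnergyGapNegative (E3 eStar)
open Summit.AtomisticToContinuum.Crystallization.Theorems.FrustratedLawDichotomySignedLedger (LawLedger net)
open Summit.AtomisticToContinuum.Crystallization.Theorems.FrustratedLawDichotomySignedLedgerErgodic (nonempty_lawLedger_of_integrableFloor)
open Summit.AtomisticToContinuum.Crystallization.Theorems.FrustratedLawDichotomyFiniteClusterGap (integrable_rootEnergy_of_ae_hardCore)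

variable {Q : Measure (Idx → E3)} {τ : ℝ}
variable {φ : ℝ → ℝ} {L : Idx → E3} {B : Finset Idx} {ρ : ℝ} {ℓ : Idx → E3 →L[ℝ] ℝ} {q : Idx → E3 → ℝ}

/-! ## §4. Law level: configurations, hard core, the MEAN-HOST GLUE, the tube targets, the typed bridges and the dial -/

/-- The labelled CONFIGURATION seen from the atom labelled `0`: the counting measure of `{L n + (u n − u 0) : n ∈ ℤ³}`. -/
def cfg (L : Idx →+ E3) (u : Idx → E3) : Measure E3 :=
  (Measure.count : Measure E3).restrict (Set.range fun n : Idx => L n + (u n - u 0))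

/-- **Tube configurations are rooted hard-core.**  If the host has minimal vector length `δ_L` (`δ_L ≤ ‖L n‖` for `n ≠ 0`) and `‖u n‖ ≤ τ`,
then `cfg L u` is a rooted `(δ_L − 2τ)`-hard-core configuration (the root is the atom labelled `0`). [folklore] -/
theorem isRootedHardCore_cfg (L : Idx →+ E3) {δL τ : ℝ} (hL : ∀ n : Idx, n ≠ 0 → δL ≤ ‖L n‖) {u : Idx → E3}
    (hu : ∀ n, ‖u n‖ ≤ τ) : IsRootedHardCore (δL - 2 * τ) (cfg L u) := by
  refine ⟨Set.range fun n : Idx => L n + (u n - u 0), ⟨0, by simp⟩, ?_, rfl⟩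
  rintro x ⟨n, rfl⟩ y ⟨m, rfl⟩ hxy
  have hsep := hL (n - m) fun h => hxy (by rw [sub_eq_zero.mp h])
  have hum : ‖u n - u m‖ ≤ 2 * τ := by rw [two_mul]; exact (norm_sub_le _ _).trans (add_le_add (hu n) (hu m))
  have hdec : (L n + (u n - u 0)) - (L m + (u m - u 0)) = L (n - m) + (u n - u m) := by rw [map_sub]; abel
  rw [dist_eq_norm, hdec]
  have h := norm_sub_le (L (n - m) + (u n - u m)) (u n - u m)
  rw [add_sub_cancel_right] at h
  linarith

/-- **WINDOW TRANSFER** [bookkeeping · ATTACKABLE-S · typed, not proved].  On rooted `δ`-hard-core labelled configurations with window increments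
`≤ ρ` the root energy is at least the window energy over `B` minus the tail `ε`: for `B ⊇ {n : ‖L n‖ ≤ R + ρ}`, `R ≥ 2^{-1/6} + ρ`, the window
terms outside `B̄_R` are negative and the tree's `…TransportPriceTail.abs_rootEnergy_sub_truncated_le` gives `ε = ½(δ⁻⁶/12 + 1/6)·250·δ⁻³·R⁻³`. -/
def WindowTransfer (L : Idx →+ E3) (δ ρ : ℝ) (B : Finset Idx) (ε : ℝ) : Prop :=
  ∀ u : Idx → E3, (∀ n ∈ B, ‖u n - u 0‖ ≤ ρ) → IsRootedHardCore δ (cfg L u) → windowEnergy lennardJones L B u - ε ≤ rootEnergy lennardJones (cfg L u)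

/-- **THE MEAN-HOST GLUE.**  A shift-stationary probability law of labelled fields whose MEAN HOST on the window is `L`, with window increments
`≤ ρ`, a.s. rooted `δ`-hard-core configurations of integrable root energy; per-bond floors at radius `ρ` + a mean second-order floor `−Θ` + the
window/tail transfer `ε` + the HOST MARGIN `e⋆ + Θ + ε < windowEnergy(host)` ⇒ `e⋆ < E_Q[rootEnergy V_LJ]`. [new: bookkeeping] -/
theorem lt_integral_rootEnergy_of_meanHost (L : Idx →+ E3) {δ ρ Θ ε C Cq : ℝ} {B : Finset Idx} {ℓ : Idx → E3 →L[ℝ] ℝ} {q : Idx → E3 → ℝ}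
    (Q : Measure (Idx → E3)) [IsProbabilityMeasure Q] (hstat : IsShiftStationary Q) (hmean : ∀ n ∈ B, ∫ u, (u n - u 0) ∂Q = 0)
    (hwin : IsWindow B ρ Q) (hcore : ∀ᵐ u ∂Q, IsRootedHardCore δ (cfg L u)) (hint : Integrable (fun u => rootEnergy lennardJones (cfg L u)) Q)
    (hcert : ∀ n ∈ B, BondFloor lennardJones (L n) ρ (ℓ n) (q n)) (hφb : ∀ n ∈ B, ∀ D : E3, ‖D‖ ≤ ρ → |lennardJones ‖L n + D‖| ≤ C)
    (hqm : ∀ n ∈ B, Measurable (q n)) (hqb : ∀ n ∈ B, ∀ D : E3, ‖D‖ ≤ ρ → |q n D| ≤ Cq) (hfloor : MeanSecondOrderFloor B q ρ Θ)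
    (hwinT : WindowTransfer L δ ρ B ε) (hmargin : eStar + Θ + ε < windowEnergy lennardJones L B 0) :
    eStar < ∫ u, rootEnergy lennardJones (cfg L u) ∂Q := by
  have hLJm : Measurable lennardJones := by unfold lennardJones; fun_prop
  have h1 : windowEnergy lennardJones L B 0 - Θ ≤ ∫ u, windowEnergy lennardJones L B u ∂Q :=
    le_integral_windowEnergy Q hmean hwin hcert hLJm hφb hqm hqb (hfloor Q ‹_› hstat hwin)
  have hIw : Integrable (windowEnergy lennardJones (⇑L) B) Q := integrable_windowEnergy hwin hLJm hφb
  have h2 : ∫ u, (windowEnergy lennardJones L B u - ε) ∂Q ≤ ∫ u, rootEnergy lennardJones (cfg L u) ∂Q := by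
    refine integral_mono_ae (hIw.sub (integrable_const ε)) hint ?_
    filter_upwards [hwin, hcore] with u hu hc using hwinT u hu hc
  rw [integral_sub hIw (integrable_const ε), integral_const, probReal_univ, one_smul] at h2
  linarith

/-- The UNIFORM TUBE of host `L` at radius `τ`: rooted configurations = `τ`-bounded displacements of the host lattice seen from an atom. -/
def uniformTube (L : Idx →+ E3) (τ : ℝ) : Set (Measure E3) := {μ | ∃ u : Idx → E3, (∀ n, ‖u n‖ ≤ τ) ∧ μ = cfg L u}
/-- **FIELD-LEVEL SINGLE-GRAIN GAP** of host `L` at tube radius `τ`: every shift-stationary `τ`-tube probability law of displacement fields with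
integrable root energy has mean root energy of its labelled configuration above `e⋆`. -/
def SingleGrainGapQ (L : Idx →+ E3) (τ : ℝ) : Prop :=
  ∀ Q : Measure (Idx → E3), IsProbabilityMeasure Q → IsShiftStationary Q → IsTube τ Q →
    Integrable (fun u => rootEnergy lennardJones (cfg L u)) Q → eStar < ∫ u, rootEnergy lennardJones (cfg L u) ∂Q

/-- **LAW-LEVEL SINGLE-GRAIN GAP** — the `p = 0` cell in the crux's own currency: every point-stationary probability law almost surely carried
by the uniform `τ`-tube of host `L` has `e⋆ < E_P[rootEnergy V_LJ]`.  (TOY RUNG: such laws violate the texture clauses of 27623.) -/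
def SingleGrainGap (L : Idx →+ E3) (τ : ℝ) : Prop :=
  ∀ P : Measure (Measure E3), IsProbabilityMeasure P → IsPointStationaryLaw P → (∀ᵐ μ ∂P, μ ∈ uniformTube L τ) →
    eStar < ∫ μ, rootEnergy lennardJones μ ∂P

/-- **LABELLING TRANSFER** [bookkeeping · ATTACKABLE-M · typed, not proved].  A point-stationary law on the uniform `τ`-tube of `L` is, through
the canonical labelling (bond labels = the lattice vector within `2τ` of the bond, `4τ < δ_L`; gauge = Chebyshev centre of `{u n}`), the image of a
SHIFT-STATIONARY `τ`-tube law `Q` of fields with integrable, equal mean root energy (re-rooting at the atom labelled `m` = the bijective point-shift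
"go to label `m`"; point-stationarity = invariance under bijective point-shifts [HevelingLast2005, Thm 3.1/4.1; Mecke1967]). -/
def LabellingTransfer (L : Idx →+ E3) (τ : ℝ) : Prop :=
  ∀ P : Measure (Measure E3), IsProbabilityMeasure P → IsPointStationaryLaw P → (∀ᵐ μ ∂P, μ ∈ uniformTube L τ) →
    ∃ Q : Measure (Idx → E3), IsProbabilityMeasure Q ∧ IsShiftStationary Q ∧ IsTube τ Q ∧
      Integrable (fun u => rootEnergy lennardJones (cfg L u)) Q ∧ ∫ μ, rootEnergy lennardJones μ ∂P = ∫ u, rootEnergy lennardJones (cfg L u) ∂Q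

/-- **THE TUBE GLUE.**  Host of minimal vector length `δ_L > 2τ`; per-bond floors at radius `2τ` over `B` + a mean second-order floor `−Θ` at
window radius `2τ` + window transfer at hard core `δ_L − 2τ` + the margin ⇒ `SingleGrainGapQ L τ` (mean host `= L` by §1). [new: bookkeeping] -/
theorem singleGrainGapQ_of_pieces (L : Idx →+ E3) {δL τ Θ ε C Cq : ℝ} {B : Finset Idx} {ℓ : Idx → E3 →L[ℝ] ℝ} {q : Idx → E3 → ℝ}
    (hL : ∀ n : Idx, n ≠ 0 → δL ≤ ‖L n‖) (hcert : ∀ n ∈ B, BondFloor lennardJones (L n) (2 * τ) (ℓ n) (q n))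
    (hφb : ∀ n ∈ B, ∀ D : E3, ‖D‖ ≤ 2 * τ → |lennardJones ‖L n + D‖| ≤ C) (hqm : ∀ n ∈ B, Measurable (q n))
    (hqb : ∀ n ∈ B, ∀ D : E3, ‖D‖ ≤ 2 * τ → |q n D| ≤ Cq) (hfloor : MeanSecondOrderFloor B q (2 * τ) Θ)
    (hwinT : WindowTransfer L (δL - 2 * τ) (2 * τ) B ε) (hmargin : eStar + Θ + ε < windowEnergy lennardJones L B 0) : SingleGrainGapQ L τ :=
  fun Q _ hstat hτ hint => lt_integral_rootEnergy_of_meanHost L Q hstat (fun n _ => integral_eval_sub_eval_zero_eq_zero Q hstat hτ n)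
    (isWindow_of_isTube B hτ) (by filter_upwards [hτ] with u hu using isRootedHardCore_cfg L hL hu) hint hcert hφb hqm hqb hfloor hwinT hmargin

/-- **FINITE-RANGE COROLLARY (the base range of the dial).**  Crude rows `q_n D = −λ_n‖D‖²`, `λ_n ≥ 0`, plus window transfer and the
margin `e⋆ + τ²Σλ + ε < windowEnergy(host)` ⇒ `SingleGrainGapQ L τ`. -/
theorem singleGrainGapQ_finiteRange (L : Idx →+ E3) {δL τ ε C : ℝ} {B : Finset Idx} {ℓ : Idx → E3 →L[ℝ] ℝ} {lam : Idx → ℝ}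
    (hL : ∀ n : Idx, n ≠ 0 → δL ≤ ‖L n‖) (hlam : ∀ n ∈ B, 0 ≤ lam n)
    (hcert : ∀ n ∈ B, BondFloor lennardJones (L n) (2 * τ) (ℓ n) fun D => -(lam n * ‖D‖ ^ 2))
    (hφb : ∀ n ∈ B, ∀ D : E3, ‖D‖ ≤ 2 * τ → |lennardJones ‖L n + D‖| ≤ C) (hwinT : WindowTransfer L (δL - 2 * τ) (2 * τ) B ε)
    (hmargin : eStar + τ ^ 2 * (∑ n ∈ B, lam n) + ε < windowEnergy lennardJones L B 0) : SingleGrainGapQ L τ := by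
  refine singleGrainGapQ_of_pieces L (q := fun n D => -(lam n * ‖D‖ ^ 2)) (Cq := (∑ n ∈ B, lam n) * (2 * τ) ^ 2) hL hcert hφb
    (fun n _ => (measurable_const.mul (measurable_norm.pow_const 2)).neg) ?_
    (meanSecondOrderFloor_of_pointwise hlam fun n _ D _ => le_rfl) hwinT ?_
  · intro n hn D hD
    rw [abs_neg, abs_of_nonneg (mul_nonneg (hlam n hn) (sq_nonneg _))]
    calc lam n * ‖D‖ ^ 2 ≤ lam n * (2 * τ) ^ 2 := mul_le_mul_of_nonneg_left (pow_le_pow_left₀ (norm_nonneg _) hD 2) (hlam n hn)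
      _ ≤ (∑ m ∈ B, lam m) * (2 * τ) ^ 2 := by gcongr; exact Finset.single_le_sum (f := lam) hlam hn
  · have h : (2 * τ) ^ 2 * (∑ n ∈ B, lam n) / 4 = τ ^ 2 * ∑ n ∈ B, lam n := by ring
    rwa [h]

/-- **THE LAW GLUE.**  Labelling transfer + the field-level gap ⇒ the law-level single-grain gap. [new: bookkeeping] -/
theorem singleGrainGap_of_transfer {L : Idx →+ E3} {τ : ℝ} (hT : LabellingTransfer L τ) (hQ : SingleGrainGapQ L τ) :
    SingleGrainGap L τ := fun P _ hstat htube => by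
  obtain ⟨Q, hQprob, hQstat, hQtube, hQint, hEq⟩ := hT P ‹_› hstat htube; exact hEq ▸ hQ Q hQprob hQstat hQtube hQint

/-- THE DIAL (field level): the single-grain gap is antitone in the tube radius. -/
theorem singleGrainGapQ_anti {L : Idx →+ E3} {τ τ' : ℝ} (h : SingleGrainGapQ L τ) (hτ : τ' ≤ τ) : SingleGrainGapQ L τ' :=
  fun Q _ hstat hτ' hint => h Q ‹_› hstat (hτ'.mono hτ) hint

/-! ## §5. The socket to the E′ assembly of record: a MEAN GAP is a LEDGER with zero transport (tree `…SignedLedgerErgodic` by name) -/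

/-- **MEAN GAP ⇒ LEDGER** (converse of `LawLedger.lt_integral_rootEnergy` up to integrability; zero transport, all roots good, charge
`c − rootEnergy`): the per-regime piece of `…SignedLedgerErgodic.nonempty_lawLedger_of_ergodic_regimes` may be delivered as a mean gap. [bookkeeping] -/
theorem nonempty_lawLedger_of_meanGap {P : Measure (Measure E3)} [IsProbabilityMeasure P] {c : ℝ}
    (hint : Integrable (fun μ : Measure E3 => rootEnergy lennardJones μ) P) (hgap : c < ∫ μ, rootEnergy lennardJones μ ∂P) :
    Nonempty (LawLedger P c) := by
  refine nonempty_lawLedger_of_integrableFloor (F := fun _ _ => 0) (G := fun _ _ => 0) (ℓ := fun μ => rootEnergy lennardJones μ - c)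
    measurable_const measurable_const (by simp) (by simp) (hint.sub (integrable_const c)) (ae_of_all _ fun μ => ?_) ?_
  · simp only [net, lintegral_zero, ENNReal.toReal_zero, sub_zero, add_zero]; linarith
  · rw [integral_sub hint (integrable_const c), integral_const, probReal_univ, one_smul]; linarith

/-- **THE SINGLE-GRAIN PIECE IN THE ASSEMBLY'S CURRENCY.**  For a host of minimal vector length `δ_L > 2τ`, the law-level single-grain gap at
radius `τ` yields `Nonempty (LawLedger P e⋆)` for every point-stationary probability law a.s. carried by the uniform `τ`-tube (hard core
`δ_L − 2τ` by `isRootedHardCore_cfg`, integrability by the tree's `integrable_rootEnergy_of_ae_hardCore`).  The regime `uniformTube L τ` is a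
translation-invariant property of the ATOM SET (re-rooting invariance by `…SignedLedgerRegimes.rerootInvariant_of_translationInvariant`);
its `MeasurableSet` is OWED (node memo, regime list). [new: bookkeeping] -/
theorem nonempty_lawLedger_of_singleGrainGap {L : Idx →+ E3} {δL τ : ℝ} (hL : ∀ n : Idx, n ≠ 0 → δL ≤ ‖L n‖) (hτ : 2 * τ < δL)
    (h : SingleGrainGap L τ) {P : Measure (Measure E3)} [IsProbabilityMeasure P] (hstat : IsPointStationaryLaw P)
    (htube : ∀ᵐ μ ∂P, μ ∈ uniformTube L τ) : Nonempty (LawLedger P eStar) := by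
  have hcore : ∀ᵐ μ ∂P, IsRootedHardCore (δL - 2 * τ) μ := by
    filter_upwards [htube] with μ hμ
    obtain ⟨u, hu, rfl⟩ := hμ
    exact isRootedHardCore_cfg L hL hu
  exact nonempty_lawLedger_of_meanGap (integrable_rootEnergy_of_ae_hardCore (by linarith) hcore) (h P ‹_› hstat htube)

end Summit.AtomisticToContinuum.Crystallization.Theorems.FrustratedLawDichotomySingleGrainTube

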